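import Summits.Langlands.Langlands.Theorems.SqrtFiveQuarticCoversW5DescentLocal
import HarnessLib

/-!
# Route `Langlands/SqrtFiveQuarticCovers`, sheet 4.5 (`CertB3E7`, stmt-Langlands-23416), row 8:
# the curve `W⁵ : Y² = X³ + 1470X² − 8575X` (the `5`-twist of Cremona `49a4`, conductor `1225`),
# its `2`-isogenous curve `W⁵′ : Y² = X³ − 2940X² + 2195200X`, the excluded square classes in
# curve coordinates, and the integer non-squares of the torsion step

Cell lg-quartmod (F-L1), seat eng-7 g5; module 2/4 toward the kernel theorem
`hQ5 : ∀ X Y : ℚ, Y² = X³ + 1470X² − 8575X → X = 0` (the `ℚ`-form of row 8 of the NAMED-INPUT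
TABLE, `…CertB3E7MordellWeilQ.lean` p677449).  Verbatim the design of
`Literature/NumberTheory/EllipticCurves/Curve49A1Points.lean` (49a1): the curve is the literal
`⟨0, 1470, 0, -8575, 0⟩ : WeierstrassCurve ℚ` (no abbreviation), `IsElliptic` / `IsIntegral ℤ`
are theorems supplied by `haveI`.  Contents:

* basics: `Δ = 2582630848000000 = 2¹²·5⁶·7⁹ ≠ 0`, integrality, the affine equation, `T = (0,0)`
  nonsingular, the prime divisors of `b = −8575 = −5²·7³` and `b′ = 2195200 = 2⁸·5²·7³`;
* the dead torsors of `…W5DescentLocal.lean` in curve coordinates: on `W⁵` no point with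
  `x = −w²`, `5x = r²`, `−5x = r²`; on `W⁵′` none with `2X = r²`, `5X = r²`, `10X = r²`
  (`w, r ≠ 0`); and translation by the `2`-torsion point stays on the curve
  (`(x,y) ↦ (−8575/x, 8575y/x²)`, resp. `(X,Y) ↦ (2195200/X, −2195200Y/X²)`);
* integer non-squares for the torsion step of `…W5DescentRatPoints.lean`: `n² ≠ 548800`, and
  `v² = w⁴ + 1470w² − 8575` has no solution with `w ∣ 8575` (twelve divisors, each value negative
  or strictly between consecutive squares).

HONEST STATUS: elementary algebra/arithmetic about ONE explicit elliptic curve over `ℚ`; nothing here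
is a modularity or BSD statement.  References: [SilvermanAEC2009] III.1, X.4.9;
Silverman–Tate III.5–6.
-/

noncomputable section

open scoped Classical NNReal

set_option linter.dupNamespace false -- project-wide option; `Summit.Langlands.Langlands` is the mandated namespace

namespace Summit.Langlands.Langlands.Theorems.SqrtFiveQuarticCovers.W5Descent

open Literature.NumberTheory.EllipticCurves _root_.WeierstrassCurve
  Literature.NumberTheory.EllipticCurves.KramerTwoDescent

/-! ### The curve `W⁵ : Y² = X³ + 1470X² − 8575X` -/

/-- `Δ(W⁵) = 16·b²·(a² − 4b) = 2582630848000000 = 2¹²·5⁶·7⁹`. [folklore] -/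
theorem Δ_eq : (⟨0, 1470, 0, -8575, 0⟩ : WeierstrassCurve ℚ).Δ = 2582630848000000 := by
  norm_num [WeierstrassCurve.Δ, b₂, b₄, b₆, b₈]

/-- `W⁵` is an elliptic curve (`Δ ≠ 0`). [folklore] -/
theorem isElliptic : (⟨0, 1470, 0, -8575, 0⟩ : WeierstrassCurve ℚ).IsElliptic :=
  ⟨by rw [Δ_eq]; norm_num⟩

/-- The model has integer coefficients. [folklore] -/
theorem isIntegral : (⟨0, 1470, 0, -8575, 0⟩ : WeierstrassCurve ℚ).IsIntegral ℤ :=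
  ⟨⟨⟨0, 1470, 0, -8575, 0⟩, by ext <;> simp [baseChange, map]⟩⟩

/-- The affine equation of `W⁵`: `Y² = X³ + 1470X² − 8575X`. [folklore] -/
theorem equation_iff (x y : ℚ) :
    (⟨0, 1470, 0, -8575, 0⟩ : WeierstrassCurve ℚ).toAffine.Equation x y ↔
      y ^ 2 = x ^ 3 + 1470 * x ^ 2 - 8575 * x := by
  rw [Affine.equation_iff]
  constructor <;> intro h <;> linear_combination h

/-- `T = (0, 0)` is a nonsingular point of `W⁵` (`a₆ = 0`, `a₄ = −8575 ≠ 0`). [folklore] -/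
theorem nonsingular_T : (⟨0, 1470, 0, -8575, 0⟩ : WeierstrassCurve ℚ).toAffine.Nonsingular 0 0 := by
  rw [Affine.nonsingular_zero]
  norm_num

/-- A prime `p` with `(p : ℤ) ∣ −8575 = −5²·7³` is `5` or `7`. [folklore] -/
theorem eq_five_or_seven_of_dvd {p : ℕ} (hp : p.Prime) (hd : (p : ℤ) ∣ -8575) : p = 5 ∨ p = 7 := by
  have h : p ∣ 5 ^ 2 * 7 ^ 3 := by
    have h' : (p : ℤ) ∣ 8575 := (Int.dvd_neg).mp hd
    have h'' : p ∣ 8575 := by exact_mod_cast h'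
    simpa using h''
  rcases (Nat.Prime.dvd_mul hp).mp h with h | h
  · exact Or.inl ((Nat.prime_dvd_prime_iff_eq hp (by decide)).mp (hp.dvd_of_dvd_pow h))
  · exact Or.inr ((Nat.prime_dvd_prime_iff_eq hp (by decide)).mp (hp.dvd_of_dvd_pow h))

/-- A prime `p` with `(p : ℤ) ∣ 2195200 = 2⁸·5²·7³` is `2`, `5` or `7`. [folklore] -/
theorem eq_two_or_five_or_seven_of_dvd {p : ℕ} (hp : p.Prime) (hd : (p : ℤ) ∣ 2195200) :
    p = 2 ∨ p = 5 ∨ p = 7 := by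
  have h : p ∣ (2 ^ 8 * 5 ^ 2) * 7 ^ 3 := by
    have h'' : p ∣ 2195200 := by exact_mod_cast hd
    simpa using h''
  rcases (Nat.Prime.dvd_mul hp).mp h with h | h
  · rcases (Nat.Prime.dvd_mul hp).mp h with h | h
    · exact Or.inl ((Nat.prime_dvd_prime_iff_eq hp Nat.prime_two).mp (hp.dvd_of_dvd_pow h))
    · exact Or.inr (Or.inl ((Nat.prime_dvd_prime_iff_eq hp (by decide)).mp (hp.dvd_of_dvd_pow h)))
  · exact Or.inr (Or.inr ((Nat.prime_dvd_prime_iff_eq hp (by decide)).mp (hp.dvd_of_dvd_pow h)))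

/-! ### The excluded classes, in curve coordinates -/

/-- **`[−1] ∉ α(W⁵(ℚ))`**: no rational point with `x = −w²`, `w ≠ 0` (`(y/w)² = −w⁴ + 1470w² + 8575`,
`negOne_rat_false`). [folklore] -/
theorem neg_ne_sq {x y w : ℚ} (he : y ^ 2 = x ^ 3 + 1470 * x ^ 2 - 8575 * x)
    (hw : w ≠ 0) (hx : x = -w ^ 2) : False := by
  refine negOne_rat_false w (y / w) ?_
  rw [div_pow, div_eq_iff (pow_ne_zero 2 hw)]
  rw [hx] at he
  linear_combination he

/-- **`[5] ∉ α(W⁵(ℚ))`**: no rational point with `5x = r²`, `r ≠ 0` (`x = 5u²`, `u = r/5`,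
`(y/r)² = 5u⁴ + 1470u² − 1715`, `five_rat_false`). [folklore] -/
theorem five_mul_ne_sq {x y r : ℚ} (he : y ^ 2 = x ^ 3 + 1470 * x ^ 2 - 8575 * x)
    (hr : r ≠ 0) (hx : 5 * x = r ^ 2) : False := by
  refine five_rat_false (r / 5) (y / r) ?_
  have hx' : x = r ^ 2 / 5 := by linear_combination hx / 5
  subst hx'
  rw [div_pow y, div_eq_iff (pow_ne_zero 2 hr)]
  linear_combination he

/-- **`[−5] ∉ α(W⁵(ℚ))`**: no rational point with `−5x = r²`, `r ≠ 0` (`x = −5u²`, `u = r/5`,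
`(y/r)² = −5u⁴ + 1470u² + 1715`, `negFive_rat_false`). [folklore] -/
theorem negFive_mul_ne_sq {x y r : ℚ} (he : y ^ 2 = x ^ 3 + 1470 * x ^ 2 - 8575 * x)
    (hr : r ≠ 0) (hx : -5 * x = r ^ 2) : False := by
  refine negFive_rat_false (r / 5) (y / r) ?_
  have hx' : x = -r ^ 2 / 5 := by linear_combination -hx / 5
  subst hx'
  rw [div_pow y, div_eq_iff (pow_ne_zero 2 hr)]
  linear_combination he

/-- Translation by `T` on `W⁵`: `(x, y) ↦ (−8575/x, 8575y/x²)` stays on the curve. [folklore] -/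
theorem transl_on_curve {x y : ℚ} (he : y ^ 2 = x ^ 3 + 1470 * x ^ 2 - 8575 * x) (hx : x ≠ 0) :
    (8575 * y / x ^ 2) ^ 2 = (-8575 / x) ^ 3 + 1470 * (-8575 / x) ^ 2 - 8575 * (-8575 / x) := by
  field_simp
  linear_combination he

/-- **`[2] ∉ α′(W⁵′(ℚ))`**: no rational point of `W⁵′` with `2X = r²`, `r ≠ 0` (`X = 2u²`, `u = r/2`,
`(Y/r)² = 2u⁴ − 2940u² + 1097600`, `coTwo_rat_false`). [folklore] -/
theorem co_two_mul_ne_sq {X Y r : ℚ} (he : Y ^ 2 = X ^ 3 - 2940 * X ^ 2 + 2195200 * X)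
    (hr : r ≠ 0) (hX : 2 * X = r ^ 2) : False := by
  refine coTwo_rat_false (r / 2) (Y / r) ?_
  have hX' : X = r ^ 2 / 2 := by linear_combination hX / 2
  subst hX'
  rw [div_pow Y, div_eq_iff (pow_ne_zero 2 hr)]
  linear_combination he

/-- **`[5] ∉ α′(W⁵′(ℚ))`**: no rational point of `W⁵′` with `5X = r²`, `r ≠ 0`
(`coFive_rat_false`). [folklore] -/
theorem co_five_mul_ne_sq {X Y r : ℚ} (he : Y ^ 2 = X ^ 3 - 2940 * X ^ 2 + 2195200 * X)
    (hr : r ≠ 0) (hX : 5 * X = r ^ 2) : False := by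
  refine coFive_rat_false (r / 5) (Y / r) ?_
  have hX' : X = r ^ 2 / 5 := by linear_combination hX / 5
  subst hX'
  rw [div_pow Y, div_eq_iff (pow_ne_zero 2 hr)]
  linear_combination he

/-- **`[10] ∉ α′(W⁵′(ℚ))`**: no rational point of `W⁵′` with `10X = r²`, `r ≠ 0`
(`coTen_rat_false`). [folklore] -/
theorem co_ten_mul_ne_sq {X Y r : ℚ} (he : Y ^ 2 = X ^ 3 - 2940 * X ^ 2 + 2195200 * X)
    (hr : r ≠ 0) (hX : 10 * X = r ^ 2) : False := by
  refine coTen_rat_false (r / 10) (Y / r) ?_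
  have hX' : X = r ^ 2 / 10 := by linear_combination hX / 10
  subst hX'
  rw [div_pow Y, div_eq_iff (pow_ne_zero 2 hr)]
  linear_combination he

/-- Translation by `T′` on `W⁵′`: `(X, Y) ↦ (2195200/X, −2195200Y/X²)` stays on the curve.
[folklore] -/
theorem co_transl_on_curve {X Y : ℚ} (he : Y ^ 2 = X ^ 3 - 2940 * X ^ 2 + 2195200 * X)
    (hX : X ≠ 0) :
    (-2195200 * Y / X ^ 2) ^ 2 =
      (2195200 / X) ^ 3 - 2940 * (2195200 / X) ^ 2 + 2195200 * (2195200 / X) := by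
  field_simp
  linear_combination he

/-! ### Integer non-squares -/

/-- An integer strictly between two consecutive squares is not a square. [folklore] -/
theorem int_sq_ne_of_lt_lt {n c k : ℤ} (hk : 0 ≤ k) (h1 : k ^ 2 < c) (h2 : c < (k + 1) ^ 2)
    (h : n ^ 2 = c) : False := by
  have hlow : k ^ 2 < n ^ 2 := by rw [h]; exact h1
  have hup : n ^ 2 < (k + 1) ^ 2 := by rw [h]; exact h2
  have h3 : |k| < |n| := sq_lt_sq.mp hlow
  have h4 : |n| < |k + 1| := sq_lt_sq.mp hup
  rw [abs_of_nonneg hk] at h3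
  rw [abs_of_nonneg (by omega : (0 : ℤ) ≤ k + 1)] at h4
  rcases abs_choice n with hn | hn <;> rw [hn] at h3 h4 <;> omega

/-- `n² ≠ 548800 = 2⁶·5²·7³` (`740² < 548800 < 741²`). [folklore] -/
theorem int_sq_ne_548800 (n : ℤ) : n ^ 2 ≠ 548800 := fun h =>
  int_sq_ne_of_lt_lt (k := 740) (by norm_num) (by norm_num) (by norm_num) h

/-- One torsion case: from `|w| = c` and `v² = w⁴ + 1470w² − 8575`, a bracketing
`k² < c⁴ + 1470c² − 8575 < (k+1)²` is contradictory. [folklore] -/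
theorem torsion_case {w v : ℤ} {c : ℕ} (hc : w.natAbs = c)
    (h : v ^ 2 = (w ^ 2) ^ 2 + 1470 * w ^ 2 - 8575) (k : ℤ) (hk : 0 ≤ k)
    (h1 : k ^ 2 < ((c : ℤ) ^ 2) ^ 2 + 1470 * (c : ℤ) ^ 2 - 8575)
    (h2 : ((c : ℤ) ^ 2) ^ 2 + 1470 * (c : ℤ) ^ 2 - 8575 < (k + 1) ^ 2) : False := by
  have hw2 : w ^ 2 = (c : ℤ) ^ 2 := by rw [← hc]; exact (Int.natAbs_sq w).symm
  rw [hw2] at h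
  exact int_sq_ne_of_lt_lt hk h1 h2 h

/-- **`v² = w⁴ + 1470w² − 8575` has no integer solution with `w ∣ 8575`**: the twelve divisors
`|w| ∈ {1, 5, 7, 25, 35, 49, 175, 245, 343, 1225, 1715, 8575}` give `−7104 < 0` resp. an integer
strictly between two consecutive squares (e.g. `169² < 28800 < 170²` for `|w| = 5`). [folklore] -/
theorem quartic_ne_sq_of_dvd {w v : ℤ} (hd : w ∣ 8575)
    (h : v ^ 2 = (w ^ 2) ^ 2 + 1470 * w ^ 2 - 8575) : False := by
  have hn : w.natAbs ∣ 5 ^ 2 * 7 ^ 3 := by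
    have := Int.natAbs_dvd_natAbs.mpr hd
    simpa using this
  obtain ⟨y, z, hy, hz, hyz⟩ := Nat.dvd_mul.mp hn
  obtain ⟨i, hi, rfl⟩ := (Nat.dvd_prime_pow Nat.prime_five).mp hy
  obtain ⟨j, hj, rfl⟩ := (Nat.dvd_prime_pow fact_prime_seven.out).mp hz
  interval_cases i <;> interval_cases j <;> norm_num at hyz
  · -- `|w| = 1`: `v² = -7104 < 0`
    have hw2 : w ^ 2 = 1 := by rw [← Int.natAbs_sq w, ← hyz]; norm_num
    rw [hw2] at h
    nlinarith [sq_nonneg v]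
  · exact torsion_case hyz.symm h 256 (by norm_num) (by norm_num) (by norm_num)
  · exact torsion_case hyz.symm h 3047 (by norm_num) (by norm_num) (by norm_num)
  · exact torsion_case hyz.symm h 118381 (by norm_num) (by norm_num) (by norm_num)
  · exact torsion_case hyz.symm h 169 (by norm_num) (by norm_num) (by norm_num)
  · exact torsion_case hyz.symm h 1814 (by norm_num) (by norm_num) (by norm_num)
  · exact torsion_case hyz.symm h 60755 (by norm_num) (by norm_num) (by norm_num)
  · exact torsion_case hyz.symm h 2941959 (by norm_num) (by norm_num) (by norm_num)
  · exact torsion_case hyz.symm h 1140 (by norm_num) (by norm_num) (by norm_num)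
  · exact torsion_case hyz.symm h 31351 (by norm_num) (by norm_num) (by norm_num)
  · exact torsion_case hyz.symm h 1501359 (by norm_num) (by norm_num) (by norm_num)
  · exact torsion_case hyz.symm h 73531359 (by norm_num) (by norm_num) (by norm_num)

end Summit.Langlands.Langlands.Theorems.SqrtFiveQuarticCovers.W5Descent

end
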